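/-
Copyright: cell pub-balaban-gaps (YM BLITZ Y1, track G1), seat g1-p2 GEN 10 (unit `pub-balaban-gaps-g1-p2`).  Row (D4) NODE O,
JUNCTION J-3 (multi-level): the COVARIANT DERIVATIVE LETTERS of the Green-function block walk expansion AT `U`, through the gauge.
`D4WalkBlockCovariantGaugeMultiLevel` transfers 84's expansion from the gauge-transformed pair `U^g` to `U` for the VALUE letters only (flat
differences do not pass a site gauge).  With `D4WalkBlockCovariantDerivative`: 84's level-weighted FLAT letters `{w², w∂, w∂⁻}` at `U^g`
give the level-weighted COVARIANT letters `{w², w∇_{U^g}, w∇⁻_{U^g}}` term by term (relative letters `covBU = {1, 1 + 2Lα₀,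
(1 + Lα₀)Le^{δ₁} + L²α₀}`), and THESE conjugate: every term of the expansion at `U` carries print's `(L^jη)^{−1}|∇_U G|`-letters, constants
`× rr′`.  HONEST FRAMING: `U`, `g` hypothesis SHAPES (the gauge is NOT produced from (3.35)–(3.36) here); nothing of Bałaban's asserted;
(D4) NOT discharged (instance 0∕1); NOT BetaPertH, NOT continuum, NOT Clay.
-/
import Summits.QuantumFields.BalabanUV.Gaps.D4WalkBlockCovariantGaugeMultiLevel
import Summits.QuantumFields.BalabanUV.Gaps.D4WalkBlockCovariantDerivativeLetters

/-!
# `Gaps.D4WalkBlockCovariantGaugeDerivMultiLevel` — covariant derivative letters of the Green-function expansion at `U` through the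
# gauge transfer (cell pub-balaban-gaps, seat g1-p2 gen 10)

HONEST DEPENDENCY (cell pub-balaban, verbatim): continuum YM on T⁴ ⇐ BetaPertH ∧ nine spine estimates (0/9 proved);
BetaPertH ⇐ (D1) ∧ (D4) ∧ CAP+tail.

* §1 = `D4WalkBlockCovariantDerivativeLetters` (`covBU`, `covDopU_letters_of_covDopW`), imported.
* §2 = 83's §6 (`eta_mul_levW_le_one`, `levW_tshift_symm_le_mul`, `window_weighted`, `weighted_window_of_lev`), imported.
* §3 **`blockWalkExpansion_covariantGreenCov_multiLevelTorus`** (84's END + the covariant-letter conjunct, no gauge) and the END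
  **`blockWalkExpansion_covariantGreen_gaugeCov_multiLevelTorus`**: 91b's END (84's hypotheses on the gauge-transformed pair
  ⟹ the Green function AT `U` is a block walk expansion, constants `× rr′`) WITH the conjunct «every term carries the level-weighted
  COVARIANT letters `{w², w∇_{U,μ}, w∇⁻_{U,μ}}` at `U`, relative letters `covBU δ₁ L (Lα₀)`, same walks, distances and rate `δ₁ − 2μ`».
WHAT IT IS NOT.  The gauge from (3.35)–(3.36); (D4) instance 0∕1; words of row (D4) UNCHANGED.

References: T. Bałaban, Comm. Math. Phys. **99** (1985) 389–434 [B9], Thm 3.1 (3.42) p. 397, p. 398, (3.37) p. 396, (3.61) p. 402,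
Cor. 3.5 p. 407, Cor. 3.6 p. 408; Comm. Math. Phys. **96** (1984) [4], (2.2) p. 224; Comm. Math. Phys. **116** (1988) [II], (1.11) p. 5, p. 15.
-/

noncomputable section

namespace Summit.QuantumFields.BalabanUV.Gaps.D4WalkBlockCovariantGaugeDerivMultiLevel

open Metric NormedSpace
open scoped Matrix
open Literature.MathematicalPhysics.QuantumFieldTheory.Balaban1983to89
open Literature.MathematicalPhysics.QuantumFieldTheory.Balaban1983to89.B4Reflection242 (boxDom blk)
open Literature.MathematicalPhysics.QuantumFieldTheory.Balaban1983to89.B9SectDWalk (DomBy)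
open Literature.MathematicalPhysics.QuantumFieldTheory.Balaban1983to89.B9Thm34Ext (toB6)
open Literature.MathematicalPhysics.QuantumFieldTheory.Balaban1983to89.B9Thm37GlueTorus (torusGeom tdist1)
open Literature.MathematicalPhysics.QuantumFieldTheory.Balaban1983to89.TreeLengthTorus (TPt)
open Literature.MathematicalPhysics.QuantumFieldTheory.Balaban1983to89.B5TorusCover (UT)
open Literature.MathematicalPhysics.QuantumFieldTheory.Balaban1983to89.B11SectG (RowSum)
open Literature.MathematicalPhysics.QuantumFieldTheory.Balaban1983to89.B6MultiLevelBoxOperator (N0 levC)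
open Literature.MathematicalPhysics.QuantumFieldTheory.Balaban1983to89.B6MultiLevelTorusOperator (TDomains gmlT tshift unitVec)
open Literature.MathematicalPhysics.QuantumFieldTheory.Balaban1983to89.B6Ineq243TwoLevelBox (aNext)
open Summit.QuantumFields.BalabanUV.Gaps.D4WalkBlock (blockNorm blockNorm_nonneg BlockWalkExpansion)
open Summit.QuantumFields.BalabanUV.Gaps.D4WalkBlockConjugate (blockNorm_local_mul_le blockNorm_mul_local_le)
open Summit.QuantumFields.BalabanUV.Gaps.D4WalkBlockMultiLevelGeometry (cubeML)
open Summit.QuantumFields.BalabanUV.Gaps.D4WalkBlockShiftAlgebra (fibD relab Sfw Sbw Dfw fibD_local)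
open Summit.QuantumFields.BalabanUV.Gaps.D4WalkBlockShiftStep (covLap)
open Summit.QuantumFields.BalabanUV.Gaps.D4WalkBlockShiftWeighted (wOp covDopW covBW covAlphaW)
open Summit.QuantumFields.BalabanUV.Gaps.D4WalkBlockWeightedLettersMultiLevel (levW levW_pos)
open Summit.QuantumFields.BalabanUV.Gaps.D4WalkBlockCovariantAveragingMultiLevel (covAvgOp)
open Summit.QuantumFields.BalabanUV.Gaps.D4WalkBlockCovariantContourMultiLevel (contourT contourTi)
open Summit.QuantumFields.BalabanUV.Gaps.D4WalkBlockCovariantBondFieldMultiLevel (eta_mul_levW eta_mul_levW_le_one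
  levW_tshift_symm_le_mul window_weighted weighted_window_of_lev)
open Summit.QuantumFields.BalabanUV.Gaps.D4WalkBlockCovariantGreenMultiLevel (blockWalkExpansion_covariantGreen_multiLevelTorus)
open Summit.QuantumFields.BalabanUV.Gaps.D4WalkBlockGaugeAlgebra (fibD_mul_fibD_eq_one rowSum_fibD)
open Summit.QuantumFields.BalabanUV.Gaps.D4WalkBlockContourPath (IsPath)
open Summit.QuantumFields.BalabanUV.Gaps.D4WalkBlockCovariantGaugeMultiLevel (covGreen_gauge)
open Summit.QuantumFields.BalabanUV.Gaps.D4WalkBlockCovariantDerivative (covDf covDb covDopU covDopU_mul_conj)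
open Summit.QuantumFields.BalabanUV.Gaps.D4WalkBlockCovariantDerivativeLetters (covBU covBU_nonneg covDopU_letters_of_covDopW)

variable {d : ℕ}

/-! ## §1. (the carrier-generic conversion `covBU` ∕ `covDopU_letters_of_covDopW` lives in `D4WalkBlockCovariantDerivativeLetters`) -/



/-! ## §2. (the nested family's level-weight bookkeeping — `eta_mul_levW_le_one`, `levW_tshift_symm_le_mul`, `window_weighted`,
`weighted_window_of_lev` — lives in `D4WalkBlockCovariantBondFieldMultiLevel` §6) -/

/-! ## §3. The END: the Green function at `U` with covariant derivative letters, through the gauge -/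

section Green

variable {dd N' : ℕ} {E : Type*} [NormedAddCommGroup E] [NormedSpace ℂ E]

/-- **84's END WITH PRINT'S COVARIANT LETTERS** (no gauge): for a bond field in the (3.37) window on [4]'s nested family the Green-function
block walk expansion of `D4WalkBlockCovariantGreenMultiLevel` carries, term by term, the level-weighted COVARIANT letters
`{w², w∇_{U,μ}, w∇⁻_{U,μ}}` with the relative letters `covBU δ₁ L (Lα₀)` — 84's flat conjunct converted by §1 (for adjoint ∕ `e^{X}` consumers).
[cite: Balaban1985BackgroundPropagators, Thm 3.1 (3.42) p.397, Cor. 3.5 p.407, (3.37) p.396; Balaban1984PropagatorsII, (2.2) p.224] -/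
theorem blockWalkExpansion_covariantGreenCov_multiLevelTorus (d ℓ : ℕ) (hℓ : 1 ≤ ℓ) (aminus aplus a2minus a2plus : ℝ)
    (ha : 0 < aminus) (ha2 : 0 < a2minus) :
    ∃ δ₁ C M₀ : ℝ, ∃ N₀ : ℕ, 0 < δ₁ ∧ 0 < C ∧ 0 < M₀ ∧ 0 < N₀ ∧
      ∀ (k Mh R : ℕ), 3 ≤ Mh → M₀ ≤ ((ℓ : ℝ) + 1) * Mh → 2 * (ℓ + 1) ≤ R → N₀ + 1 ≤ R * ((ℓ + 1) * Mh) →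
      ∀ (P : Fin (d + 1) → ℕ) (hP : ∀ μ, 1 ≤ P μ) (hP4 : ∀ μ, 4 ≤ P μ) (D : TDomains d ℓ Mh k P R) (a c : ℕ → ℝ),
        (∀ i, 1 ≤ i → aminus ≤ a i ∧ a i ≤ aplus) → (∀ i, 1 ≤ i → a2minus ≤ c i ∧ c i ≤ a2plus) →
        (∀ i, 1 ≤ i → a (i + 1) = aNext ℓ (a i) (c i)) →
      ∀ (Kc : Fin (d + 1) → ℕ) [∀ i, NeZero (Kc i)], (∀ i, N0 ℓ Mh k P i = (ℓ + 1) ^ k * Kc i) →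
      ∀ (F : Type) [Fintype F] [DecidableEq F] (c₀ : B13.Consts) (Xs : Finset (UT Kc)) (Rb : ℝ)
        (U Ui : Fin (d + 1) → E → ↥(boxDom (N0 ℓ Mh k P)) → Matrix F F ℂ)
        (Γ : ↥(boxDom (N0 ℓ Mh k P)) → List (↥(boxDom (N0 ℓ Mh k P)) × Fin (d + 1))) (α₀ α₁ ε μ cμ : ℝ),
      (∀ ν y a' b, DifferentiableOn ℂ (fun u => U ν u y a' b) (ball (0 : E) Rb)) →
      (∀ ν y a' b, DifferentiableOn ℂ (fun u => Ui ν u y a' b) (ball (0 : E) Rb)) →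
      (∀ ν u y, U ν u y * Ui ν u y = 1) → 0 ≤ α₀ → 0 ≤ α₁ →
      (∀ ν, ∀ u ∈ ball (0 : E) Rb, ∀ y a', ∑ b, ‖(U ν u y - 1) a' b‖ ≤ α₀ * ((((ℓ : ℝ) + 1) ^ D.lev y.1))⁻¹) →
      (∀ ν, ∀ u ∈ ball (0 : E) Rb, ∀ y a', ∑ b, ‖(Ui ν u y - 1) a' b‖ ≤ α₀ * ((((ℓ : ℝ) + 1) ^ D.lev y.1))⁻¹) →
      (∀ ν, ∀ u ∈ ball (0 : E) Rb, ∀ x a', ∑ b, ‖(U ν u x - U ν u ((tshift (N0 ℓ Mh k P) (unitVec ν)).symm x)) a' b‖ ≤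
        α₁ * ((((ℓ : ℝ) + 1) ^ D.lev x.1))⁻¹ ^ 2) →
      (∀ x, (Γ x).length ≤ (d + 1) * (ℓ + 1) ^ D.lev x.1) →
      (∀ x, ∀ b ∈ Γ x, blk ((ℓ + 1) ^ D.lev x.1) b.1.1 = blk ((ℓ + 1) ^ D.lev x.1) x.1) →
      0 ≤ μ → 2 * μ ≤ ε → 2 * μ ≤ δ₁ - ε - μ → 0 ≤ cμ →
      RowSum (toB6 (torusGeom Kc 0 0 0) 0 True) μ cμ →
      cμ * (cμ * 1 * (1 * ((0 + ∑ j : Unit ⊕ (Fin (d + 1) ⊕ Fin (d + 1)),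
        covAlphaW (((ℓ : ℝ) + 1) * α₀) (((d : ℝ) + 1) * (α₁ + (((ℓ : ℝ) + 1) * α₀) ^ 2) +
          aplus * (Real.exp (2 * ((d : ℝ) + 1) * α₀) - 1)) j * covBW δ₁ ((ℓ : ℝ) + 1) j) * C)) * cμ) * cμ < 1 →
      ∃ (W : Type) (T : W → (TPt dd N' → ℂ) → E → Matrix (↥(boxDom (N0 ℓ Mh k P)) × F) (↥(boxDom (N0 ℓ Mh k P)) × F) ℂ)
        (SX' : Set W) (A' : W → ℝ) (D' : W → UT Kc → UT Kc → ℝ),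
        BlockWalkExpansion c₀ (fun q : ↥(boxDom (N0 ℓ Mh k P)) × F => cubeML ℓ k Kc q.1.1)
          (fun q : ↥(boxDom (N0 ℓ Mh k P)) × F => cubeML ℓ k Kc q.1.1)
          (fun (_ : TPt dd N' → ℂ) u =>
            (covLap ↥(boxDom (N0 ℓ Mh k P)) F (fun ν => tshift (N0 ℓ Mh k P) (unitVec ν)) ((((ℓ : ℝ) + 1) ^ k)⁻¹)
                (fun ν u x => U ν u x - 1) (fun ν u x => Ui ν u ((tshift (N0 ℓ Mh k P) (unitVec ν)).symm x) - 1) u +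
              (((ℓ : ℂ) + 1) ^ (2 * k) : ℂ) • covAvgOp D a (contourT Γ fun u b => U b.2 u b.1) (contourTi Γ fun u b => Ui b.2 u b.1) u)⁻¹)
          Xs Rb (ε - 2 * μ) (δ₁ - ε - μ - 2 * μ)
          (cμ * C * (1 * (1 - cμ * (cμ * 1 * (1 * ((0 + ∑ j : Unit ⊕ (Fin (d + 1) ⊕ Fin (d + 1)),
            covAlphaW (((ℓ : ℝ) + 1) * α₀) (((d : ℝ) + 1) * (α₁ + (((ℓ : ℝ) + 1) * α₀) ^ 2) +
              aplus * (Real.exp (2 * ((d : ℝ) + 1) * α₀) - 1)) j * covBW δ₁ ((ℓ : ℝ) + 1) j) * C)) * cμ) * cμ)⁻¹) * cμ)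
          T SX' A' D' (δ₁ - 2 * μ) ∧
        (∀ (j : Unit ⊕ (Fin (d + 1) ⊕ Fin (d + 1))) ω (σ : TPt dd N' → ℂ), (∀ i, ‖σ i‖ ≤ Real.exp c₀.κ₁) →
          ∀ u ∈ ball (0 : E) Rb, ∀ Y Y',
          blockNorm (fun q : ↥(boxDom (N0 ℓ Mh k P)) × F => cubeML ℓ k Kc q.1.1)
              (fun q : ↥(boxDom (N0 ℓ Mh k P)) × F => cubeML ℓ k Kc q.1.1)
              (covDopU (fun ν => tshift (N0 ℓ Mh k P) (unitVec ν)) ((((ℓ : ℝ) + 1) ^ k)⁻¹) U Ui (levW D) u j * T ω σ u) Y Y' ≤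
            covBU (ι := Fin (d + 1)) δ₁ ((ℓ : ℝ) + 1) (((ℓ : ℝ) + 1) * α₀) j * (A' ω * Real.exp (-((δ₁ - 2 * μ) * D' ω Y Y')))) ∧
        ∀ ω, DomBy (toB6 (torusGeom Kc 0 0 0) 0 True) (D' ω) := by
  obtain ⟨δ₁, C, M₀, N₀, hδ₁, hC, hM₀, hN₀, hmain⟩ :=
    blockWalkExpansion_covariantGreen_multiLevelTorus (dd := dd) (N' := N') (E := E) d ℓ hℓ aminus aplus a2minus a2plus ha ha2
  refine ⟨δ₁, C, M₀, N₀, hδ₁, hC, hM₀, hN₀, ?_⟩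
  intro k Mh R hMh hM hR hRM P hP hP4 D a c haw hcw hac Kc _ hKc F _ _ c₀ Xs Rb U Ui Γ α₀ α₁ ε μ cμ hUh hUih hinv hα₀ hα₁ hU0 hUi0
    hU1 hlen hblkΓ hμ hμε hμκ hcμ hrow hq
  have hMh1 : 1 ≤ Mh := le_trans (by norm_num) hMh
  have hR1 : 1 ≤ R := le_trans (by omega) hR
  have hL0 : (0 : ℝ) ≤ (ℓ : ℝ) + 1 := by positivity
  have hη : (0 : ℝ) < (((ℓ : ℝ) + 1) ^ k)⁻¹ := by positivity
  obtain ⟨W, T, SX', A', D', hE, hlet, hDom⟩ := hmain k Mh R hMh hM hR hRM P hP hP4 D a c haw hcw hac Kc hKc F c₀ Xs Rb U Ui Γ α₀ α₁ ε μ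
    cμ hUh hUih hinv hα₀ hα₁ hU0 hUi0 hU1 hlen hblkΓ hμ hμε hμκ hcμ hrow hq
  refine ⟨W, T, SX', A', D', hE, fun j ω σ hσ u hu Y Y' => ?_, hDom⟩
  have hUw := fun ν x a' => weighted_window_of_lev D hα₀ x (hU0 ν u hu x a')
  have hUiw := fun ν y a' => weighted_window_of_lev D hα₀ y (hUi0 ν u hu y a')
  exact covDopU_letters_of_covDopW (F := F) (sh := fun ν => tshift (N0 ℓ Mh k P) (unitVec ν)) (U := U) (Ui := Ui) (w := levW D)
    (fun x : ↥(boxDom (N0 ℓ Mh k P)) => cubeML ℓ k Kc x.1) hη (levW_pos (D := D)) (eta_mul_levW_le_one D) hL0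
    (fun ν x => levW_tshift_symm_le_mul (D := D) hR1 hMh1 ν x) (by positivity : (0 : ℝ) ≤ ((ℓ : ℝ) + 1) * α₀) u hUw hUiw (T ω σ u)
    (ρ := δ₁) (hE.A_nonneg ω) (e := fun Y Y' => Real.exp (-((δ₁ - 2 * μ) * D' ω Y Y'))) (fun Y Y' => (Real.exp_pos _).le)
    (fun j Y Y' => hlet j ω σ hσ u hu Y Y') j Y Y'

/-- **[B9] COR. 3.5 ∕ 3.6 WITH PRINT'S COVARIANT LETTERS AT `U`.**  Under the hypotheses of
`D4WalkBlockCovariantGaugeMultiLevel.blockWalkExpansion_covariantGreen_gauge_multiLevelTorus` (84's (3.37) windows for the gauge-transformed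
pair `(U^g, (U^g)⁻)`, contours from block base points, a configuration-independent site gauge with row sums `≤ r′`, `≤ r`), the Green
function `(Δ_W(U) + L^{2k}·covAvgOp(U,Γ))⁻¹` AT `U` is a block walk expansion with Cor. 3.5's walks AND every term carries the
level-weighted COVARIANT letters `{w², w∇_{U,μ}, w∇⁻_{U,μ}}` (`w = L^{k − lev}`) with the relative letters `covBU δ₁ L (Lα₀)` at the rate
`δ₁ − 2μ` — print's `(L^jη)^{−2}|G|, (L^jη)^{−1}|∇_UG|`, gauge-covariantly. [cite: Balaban1985BackgroundPropagators, Thm 3.1 (3.42) p.397, p.398, Cor. 3.5 p.407, Cor. 3.6 p.408, (3.37) p.396; Balaban1984PropagatorsII, (2.2) p.224; Balaban1988RG2Cluster, (1.11) p.5, p.15] -/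
theorem blockWalkExpansion_covariantGreen_gaugeCov_multiLevelTorus (d ℓ : ℕ) (hℓ : 1 ≤ ℓ) (aminus aplus a2minus a2plus : ℝ)
    (ha : 0 < aminus) (ha2 : 0 < a2minus) :
    ∃ δ₁ C M₀ : ℝ, ∃ N₀ : ℕ, 0 < δ₁ ∧ 0 < C ∧ 0 < M₀ ∧ 0 < N₀ ∧
      ∀ (k Mh R : ℕ), 3 ≤ Mh → M₀ ≤ ((ℓ : ℝ) + 1) * Mh → 2 * (ℓ + 1) ≤ R → N₀ + 1 ≤ R * ((ℓ + 1) * Mh) →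
      ∀ (P : Fin (d + 1) → ℕ) (hP : ∀ μ, 1 ≤ P μ) (hP4 : ∀ μ, 4 ≤ P μ) (D : TDomains d ℓ Mh k P R) (a c : ℕ → ℝ),
        (∀ i, 1 ≤ i → aminus ≤ a i ∧ a i ≤ aplus) → (∀ i, 1 ≤ i → a2minus ≤ c i ∧ c i ≤ a2plus) →
        (∀ i, 1 ≤ i → a (i + 1) = aNext ℓ (a i) (c i)) →
      ∀ (Kc : Fin (d + 1) → ℕ) [∀ i, NeZero (Kc i)], (∀ i, N0 ℓ Mh k P i = (ℓ + 1) ^ k * Kc i) →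
      ∀ (F : Type) [Fintype F] [DecidableEq F] (c₀ : B13.Consts) (Xs : Finset (UT Kc)) (Rb : ℝ)
        (U Ui : Fin (d + 1) → E → ↥(boxDom (N0 ℓ Mh k P)) → Matrix F F ℂ)
        (Γ : ↥(boxDom (N0 ℓ Mh k P)) → List (↥(boxDom (N0 ℓ Mh k P)) × Fin (d + 1)))
        (β : ↥(boxDom (N0 ℓ Mh k P)) → ↥(boxDom (N0 ℓ Mh k P))) (g gi : ↥(boxDom (N0 ℓ Mh k P)) → Matrix F F ℂ)
        (r r' α₀ α₁ ε μ cμ : ℝ),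
      (∀ x, g x * gi x = 1) → (∀ x, gi x * g x = 1) → 0 ≤ r → 0 ≤ r' → (∀ x a', ∑ b, ‖gi x a' b‖ ≤ r) →
      (∀ x a', ∑ b, ‖g x a' b‖ ≤ r') →
      (∀ x, IsPath (fun ν => tshift (N0 ℓ Mh k P) (unitVec ν)) (Γ x) (β x) x) →
      (∀ x x' : ↥(boxDom (N0 ℓ Mh k P)), blk ((ℓ + 1) ^ D.lev x.1) x'.1 = blk ((ℓ + 1) ^ D.lev x.1) x.1 → β x' = β x) →
      (∀ ν y a' b, DifferentiableOn ℂ (fun u => U ν u y a' b) (ball (0 : E) Rb)) →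
      (∀ ν y a' b, DifferentiableOn ℂ (fun u => Ui ν u y a' b) (ball (0 : E) Rb)) →
      (∀ ν u y, U ν u y * Ui ν u y = 1) → 0 ≤ α₀ → 0 ≤ α₁ →
      (∀ ν, ∀ u ∈ ball (0 : E) Rb, ∀ y a', ∑ b, ‖(g y * U ν u y * gi ((tshift (N0 ℓ Mh k P) (unitVec ν)) y) - 1) a' b‖ ≤ α₀ * ((((ℓ : ℝ) + 1) ^ D.lev y.1))⁻¹) →
      (∀ ν, ∀ u ∈ ball (0 : E) Rb, ∀ y a', ∑ b, ‖(g ((tshift (N0 ℓ Mh k P) (unitVec ν)) y) * Ui ν u y * gi y - 1) a' b‖ ≤ α₀ * ((((ℓ : ℝ) + 1) ^ D.lev y.1))⁻¹) →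
      (∀ ν, ∀ u ∈ ball (0 : E) Rb, ∀ x a', ∑ b, ‖(g x * U ν u x * gi ((tshift (N0 ℓ Mh k P) (unitVec ν)) x) -
        g ((tshift (N0 ℓ Mh k P) (unitVec ν)).symm x) * U ν u ((tshift (N0 ℓ Mh k P) (unitVec ν)).symm x) *
          gi ((tshift (N0 ℓ Mh k P) (unitVec ν)) ((tshift (N0 ℓ Mh k P) (unitVec ν)).symm x))) a' b‖ ≤
        α₁ * ((((ℓ : ℝ) + 1) ^ D.lev x.1))⁻¹ ^ 2) →
      (∀ x, (Γ x).length ≤ (d + 1) * (ℓ + 1) ^ D.lev x.1) →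
      (∀ x, ∀ b ∈ Γ x, blk ((ℓ + 1) ^ D.lev x.1) b.1.1 = blk ((ℓ + 1) ^ D.lev x.1) x.1) →
      0 ≤ μ → 2 * μ ≤ ε → 2 * μ ≤ δ₁ - ε - μ → 0 ≤ cμ →
      RowSum (toB6 (torusGeom Kc 0 0 0) 0 True) μ cμ →
      cμ * (cμ * 1 * (1 * ((0 + ∑ j : Unit ⊕ (Fin (d + 1) ⊕ Fin (d + 1)),
        covAlphaW (((ℓ : ℝ) + 1) * α₀) (((d : ℝ) + 1) * (α₁ + (((ℓ : ℝ) + 1) * α₀) ^ 2) +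
          aplus * (Real.exp (2 * ((d : ℝ) + 1) * α₀) - 1)) j * covBW δ₁ ((ℓ : ℝ) + 1) j) * C)) * cμ) * cμ < 1 →
      ∃ (W : Type) (T : W → (TPt dd N' → ℂ) → E → Matrix (↥(boxDom (N0 ℓ Mh k P)) × F) (↥(boxDom (N0 ℓ Mh k P)) × F) ℂ)
        (SX' : Set W) (A' : W → ℝ) (D' : W → UT Kc → UT Kc → ℝ),
        BlockWalkExpansion c₀ (fun q : ↥(boxDom (N0 ℓ Mh k P)) × F => cubeML ℓ k Kc q.1.1)
          (fun q : ↥(boxDom (N0 ℓ Mh k P)) × F => cubeML ℓ k Kc q.1.1)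
          (fun (_ : TPt dd N' → ℂ) u =>
            (covLap ↥(boxDom (N0 ℓ Mh k P)) F (fun ν => tshift (N0 ℓ Mh k P) (unitVec ν)) ((((ℓ : ℝ) + 1) ^ k)⁻¹)
                (fun ν u x => U ν u x - 1) (fun ν u x => Ui ν u ((tshift (N0 ℓ Mh k P) (unitVec ν)).symm x) - 1) u +
              (((ℓ : ℂ) + 1) ^ (2 * k) : ℂ) • covAvgOp D a (contourT Γ fun u b => U b.2 u b.1) (contourTi Γ fun u b => Ui b.2 u b.1) u)⁻¹)
          Xs Rb (ε - 2 * μ) (δ₁ - ε - μ - 2 * μ)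
          (r * r' * (cμ * C * (1 * (1 - cμ * (cμ * 1 * (1 * ((0 + ∑ j : Unit ⊕ (Fin (d + 1) ⊕ Fin (d + 1)),
            covAlphaW (((ℓ : ℝ) + 1) * α₀) (((d : ℝ) + 1) * (α₁ + (((ℓ : ℝ) + 1) * α₀) ^ 2) +
              aplus * (Real.exp (2 * ((d : ℝ) + 1) * α₀) - 1)) j * covBW δ₁ ((ℓ : ℝ) + 1) j) * C)) * cμ) * cμ)⁻¹) * cμ))
          T SX' A' D' (δ₁ - 2 * μ) ∧
        (∀ (j : Unit ⊕ (Fin (d + 1) ⊕ Fin (d + 1))) ω (σ : TPt dd N' → ℂ), (∀ i, ‖σ i‖ ≤ Real.exp c₀.κ₁) →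
          ∀ u ∈ ball (0 : E) Rb, ∀ Y Y',
          blockNorm (fun q : ↥(boxDom (N0 ℓ Mh k P)) × F => cubeML ℓ k Kc q.1.1)
              (fun q : ↥(boxDom (N0 ℓ Mh k P)) × F => cubeML ℓ k Kc q.1.1)
              (covDopU (fun ν => tshift (N0 ℓ Mh k P) (unitVec ν)) ((((ℓ : ℝ) + 1) ^ k)⁻¹) U Ui (levW D) u j * T ω σ u) Y Y' ≤
            covBU (ι := Fin (d + 1)) δ₁ ((ℓ : ℝ) + 1) (((ℓ : ℝ) + 1) * α₀) j * (A' ω * Real.exp (-((δ₁ - 2 * μ) * D' ω Y Y')))) ∧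
        ∀ ω, DomBy (toB6 (torusGeom Kc 0 0 0) 0 True) (D' ω) := by
  obtain ⟨δ₁, C, M₀, N₀, hδ₁, hC, hM₀, hN₀, hmain⟩ :=
    blockWalkExpansion_covariantGreen_multiLevelTorus (dd := dd) (N' := N') (E := E) d ℓ hℓ aminus aplus a2minus a2plus ha ha2
  refine ⟨δ₁, C, M₀, N₀, hδ₁, hC, hM₀, hN₀, ?_⟩
  intro k Mh R hMh hM hR hRM P hP hP4 D a c haw hcw hac Kc _ hKc F _ _ c₀ Xs Rb U Ui Γ β g gi r r' α₀ α₁ ε μ cμ hg hgi hr0 hr0' hr hr'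
    hpath hβ hUh hUih hinv hα₀ hα₁ hU0 hUi0 hU1 hlen hblkΓ hμ hμε hμκ hcμ hrow hq
  have hMh1 : 1 ≤ Mh := le_trans (by norm_num) hMh
  have hR1 : 1 ≤ R := le_trans (by omega) hR
  have hL0 : (0 : ℝ) ≤ (ℓ : ℝ) + 1 := by positivity
  have hη : (0 : ℝ) < (((ℓ : ℝ) + 1) ^ k)⁻¹ := by positivity
  -- the gauged pair: holomorphic entries, two-sided inverse (as in 91b)
  have hc : ∀ (M : Matrix F F ℂ) a' b, DifferentiableOn ℂ (fun _ : E => M a' b) (ball (0 : E) Rb) := fun M a' b =>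
    differentiableOn_const _
  have hUgh : ∀ ν y a' b, DifferentiableOn ℂ
      (fun u => (fun ν u y => g y * U ν u y * gi ((tshift (N0 ℓ Mh k P) (unitVec ν)) y)) ν u y a' b) (ball (0 : E) Rb) :=
    fun ν y a' b => D4WalkProduct.differentiableOn_mul_entry (M₁ := fun u => g y * U ν u y)
      (D4WalkProduct.differentiableOn_mul_entry (hc (g y)) (hUh ν y)) (hc _) a' b
  have hUigh : ∀ ν y a' b, DifferentiableOn ℂ
      (fun u => (fun ν u y => g ((tshift (N0 ℓ Mh k P) (unitVec ν)) y) * Ui ν u y * gi y) ν u y a' b) (ball (0 : E) Rb) :=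
    fun ν y a' b => D4WalkProduct.differentiableOn_mul_entry (M₁ := fun u => g _ * Ui ν u y)
      (D4WalkProduct.differentiableOn_mul_entry (hc (g _)) (hUih ν y)) (hc _) a' b
  have hinvg : ∀ ν u y, (fun ν u y => g y * U ν u y * gi ((tshift (N0 ℓ Mh k P) (unitVec ν)) y)) ν u y *
      (fun ν u y => g ((tshift (N0 ℓ Mh k P) (unitVec ν)) y) * Ui ν u y * gi y) ν u y = 1 := by
    intro ν u y
    show g y * U ν u y * gi ((tshift (N0 ℓ Mh k P) (unitVec ν)) y) *
      (g ((tshift (N0 ℓ Mh k P) (unitVec ν)) y) * Ui ν u y * gi y) = 1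
    calc g y * U ν u y * gi ((tshift (N0 ℓ Mh k P) (unitVec ν)) y) * (g ((tshift (N0 ℓ Mh k P) (unitVec ν)) y) * Ui ν u y * gi y)
        = g y * U ν u y * (gi ((tshift (N0 ℓ Mh k P) (unitVec ν)) y) * g ((tshift (N0 ℓ Mh k P) (unitVec ν)) y)) * Ui ν u y * gi y := by
          simp only [Matrix.mul_assoc]
      _ = 1 := by rw [hgi, Matrix.mul_one, Matrix.mul_assoc (g y), hinv, Matrix.mul_one, hg]
  obtain ⟨W, T, SX', A', D', hE, hlet, hDom⟩ := hmain k Mh R hMh hM hR hRM P hP hP4 D a c haw hcw hac Kc hKc F c₀ Xs Rb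
    (fun ν u y => g y * U ν u y * gi ((tshift (N0 ℓ Mh k P) (unitVec ν)) y))
    (fun ν u y => g ((tshift (N0 ℓ Mh k P) (unitVec ν)) y) * Ui ν u y * gi y) Γ α₀ α₁ ε μ cμ hUgh hUigh hinvg hα₀ hα₁ hU0
    hUi0 hU1 hlen hblkΓ hμ hμε hμκ hcμ hrow hq
  -- conjugate by fibD g⁻ (left) and fibD g (right): cube-local, row-bounded
  have hloc : ∀ (h : ↥(boxDom (N0 ℓ Mh k P)) → Matrix F F ℂ) (i j : ↥(boxDom (N0 ℓ Mh k P)) × F),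
      (fun q : ↥(boxDom (N0 ℓ Mh k P)) × F => cubeML ℓ k Kc q.1.1) i ≠ (fun q : ↥(boxDom (N0 ℓ Mh k P)) × F => cubeML ℓ k Kc q.1.1) j →
        fibD _ F h i j = 0 := by
    intro h i j hij
    by_contra hne
    exact hij (fibD_local (fun x : ↥(boxDom (N0 ℓ Mh k P)) => cubeML ℓ k Kc x.1) h i j hne)
  have hrow_gi : ∀ i : ↥(boxDom (N0 ℓ Mh k P)) × F, ∑ j, ‖fibD _ F gi i j‖ ≤ r := fun i => by rw [rowSum_fibD]; exact hr i.1 i.2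
  have hrow_g : ∀ i : ↥(boxDom (N0 ℓ Mh k P)) × F, ∑ j, ‖fibD _ F g i j‖ ≤ r' := fun i => by rw [rowSum_fibD]; exact hr' i.1 i.2
  have hconj := hE.conj (fibD _ F gi) (fibD _ F g) (hloc gi) (hloc g) hr0 hr0' hrow_gi hrow_g
  refine ⟨W, _, SX', _, D', hconj.congrK (fun σ u _ _ => ?_), ?_, hDom⟩
  · -- K_U = fibD g⁻ · K_{U^g} · fibD g
    have key := covGreen_gauge D a Γ β U Ui hg hgi hpath hβ ((((ℓ : ℝ) + 1) ^ k)⁻¹) (((ℓ : ℂ) + 1) ^ (2 * k) : ℂ) u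
    rw [key]
    simp only [← Matrix.mul_assoc]
    rw [fibD_mul_fibD_eq_one hgi, Matrix.one_mul, Matrix.mul_assoc, fibD_mul_fibD_eq_one hgi, Matrix.mul_one]
  · -- the covariant letters: at `U^g` from 84's flat weighted letters (§1), then through the gauge (`covDopU_mul_conj`)
    intro j ω σ hσ u hu Y Y'
    have hA' : 0 ≤ A' ω := hE.A_nonneg ω
    -- windows of the gauged pair in weighted form, `ηw ≤ 1`, backward ratio `L`
    have hUw : ∀ ν x a', ∑ b, ‖((fun ν u y => g y * U ν u y * gi ((tshift (N0 ℓ Mh k P) (unitVec ν)) y)) ν u x - 1) a' b‖ ≤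
        (((ℓ : ℝ) + 1) ^ k)⁻¹ * (((ℓ : ℝ) + 1) * α₀) * levW D x := fun ν x a' => weighted_window_of_lev D hα₀ x (hU0 ν u hu x a')
    have hUiw : ∀ ν y a', ∑ b, ‖((fun ν u y => g ((tshift (N0 ℓ Mh k P) (unitVec ν)) y) * Ui ν u y * gi y) ν u y - 1) a' b‖ ≤
        (((ℓ : ℝ) + 1) ^ k)⁻¹ * (((ℓ : ℝ) + 1) * α₀) * levW D y := fun ν y a' => weighted_window_of_lev D hα₀ y (hUi0 ν u hu y a')
    have hcovg := covDopU_letters_of_covDopW (F := F) (sh := fun ν => tshift (N0 ℓ Mh k P) (unitVec ν))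
      (U := fun ν u y => g y * U ν u y * gi ((tshift (N0 ℓ Mh k P) (unitVec ν)) y))
      (Ui := fun ν u y => g ((tshift (N0 ℓ Mh k P) (unitVec ν)) y) * Ui ν u y * gi y) (w := levW D)
      (fun x : ↥(boxDom (N0 ℓ Mh k P)) => cubeML ℓ k Kc x.1) hη (levW_pos (D := D)) (eta_mul_levW_le_one D) hL0
      (fun ν x => levW_tshift_symm_le_mul (D := D) hR1 hMh1 ν x) (by positivity : (0 : ℝ) ≤ ((ℓ : ℝ) + 1) * α₀) u hUw hUiw (T ω σ u)
      (ρ := δ₁) hA' (e := fun Y Y' => Real.exp (-((δ₁ - 2 * μ) * D' ω Y Y'))) (fun Y Y' => (Real.exp_pos _).le)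
      (fun j Y Y' => hlet j ω σ hσ u hu Y Y') j
    -- through the gauge
    have e := covDopU_mul_conj (sh := fun ν => tshift (N0 ℓ Mh k P) (unitVec ν)) (η := (((ℓ : ℝ) + 1) ^ k)⁻¹) (U := U)
      (Ui := Ui) (w := levW D) hg hgi u (T ω σ u) j
    rw [e, Matrix.mul_assoc]
    calc blockNorm _ _ (fibD _ F gi * ((covDopU (fun ν => tshift (N0 ℓ Mh k P) (unitVec ν)) ((((ℓ : ℝ) + 1) ^ k)⁻¹)
            (fun ν u x => g x * U ν u x * gi ((tshift (N0 ℓ Mh k P) (unitVec ν)) x))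
            (fun ν u y => g ((tshift (N0 ℓ Mh k P) (unitVec ν)) y) * Ui ν u y * gi y) (levW D) u j * T ω σ u) * fibD _ F g)) Y Y'
        ≤ r * (blockNorm _ _ (covDopU (fun ν => tshift (N0 ℓ Mh k P) (unitVec ν)) ((((ℓ : ℝ) + 1) ^ k)⁻¹)
            (fun ν u x => g x * U ν u x * gi ((tshift (N0 ℓ Mh k P) (unitVec ν)) x))
            (fun ν u y => g ((tshift (N0 ℓ Mh k P) (unitVec ν)) y) * Ui ν u y * gi y) (levW D) u j * T ω σ u) Y Y' * r') :=
          (blockNorm_local_mul_le _ _ _ (hloc gi) hr0 hrow_gi _ Y Y').trans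
            (mul_le_mul_of_nonneg_left (blockNorm_mul_local_le _ _ _ _ (hloc g) hr0' hrow_g Y Y') hr0)
      _ ≤ r * (covBU (ι := Fin (d + 1)) δ₁ ((ℓ : ℝ) + 1) (((ℓ : ℝ) + 1) * α₀) j *
            (A' ω * Real.exp (-((δ₁ - 2 * μ) * D' ω Y Y'))) * r') :=
          mul_le_mul_of_nonneg_left (mul_le_mul_of_nonneg_right (hcovg Y Y') hr0') hr0
      _ = _ := by ring

end Green

end Summit.QuantumFields.BalabanUV.Gaps.D4WalkBlockCovariantGaugeDerivMultiLevel

end
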